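import Mathlib
import Summits.ValiantsHypothesis.ValiantsHypothesis.Theorems.LiouvilleSarnakLiouvilleCutRankModEightBarrier
import Summits.ValiantsHypothesis.ValiantsHypothesis.Theorems.LiouvilleSarnakAlignedTypeIOfDigitalBilinear
import Summits.ValiantsHypothesis.ValiantsHypothesis.Theorems.LiouvilleSarnakAlignedCutRank

/-!
# Route LiouvilleSarnak — crux `LiouvilleCutRank` (stmt-ValiantsHypothesis-14775): the relaxed-model
# hypothesis `S_D` is FALSE for every multiplier budget inside a conductor-`8` pattern

`…RelaxedModelBridge.lean` (p834700): for any finite `D`, the combinatorial hypothesis `S_D` — "for every `W` some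
level `n` at which every `±1` sign function `g` on `[1,4^n]` with `g(d m) = λ(d) g(m)` (`d ∈ D`) has `≥ 2^W`
distinct rows on every cut" — implies the crux.  This file closes the small budgets kernel-side:

* ★ `not_relaxedHypothesis_of_mod8` — if every `d ∈ D` is `2` or a prime `≡ ±3 (mod 8)` (e.g. `D = {2,3,5}`,
  `{2,3,5,11,13,19}`), then `S_D` is false: the `χ₈`-twin of `…ModEightBarrier` is in the model for every `n`
  and has `≤ 2^6` distinct rows on the ALIGNED cut (`rank ≤ 6`, `±1` rows `≤ 2^{rank}`).
* ★ `not_relaxedHypothesis_of_mod4` — the same for `D ⊆ {2} ∪ {primes ≡ 3 (mod 4)}` (e.g. `{2,3,7,11}`) from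
  the `χ₄`-twin of `…MultiplicativeBarrier` (`rank ≤ 4`).
* `not_relaxedHypothesis_two_three_five`, `not_relaxedHypothesis_two_three_seven` — the instances.

So among initial segments of the primes, `D = {2,3,5,7}` is the first for which `S_D` is not refuted by a twin
(the third conductor-`8` character `χ₄χ₈` kills `D ⊆ {2} ∪ {p ≡ 5, 7 (8)}`, not formalised); the exact small-level
data on the bridge file (`13/16, 24/32, 44/64` distinct rows forced on Thue–Morse cuts, `24/32` on the aligned cut)
are for that `D`.  Honest framing: bookkeeping between two landed files; `LiouvilleCutRank`,
`DigitalBilinearLiouville`, `AlgebraicSarnak` stay OPEN; nothing bears on `VP ≠ VNP`.  No definitions.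
-/

set_option linter.dupNamespace false

noncomputable section

namespace Summit.ValiantsHypothesis.ValiantsHypothesis.Theorems.LiouvilleSarnakLiouvilleCutRank.RelaxedModelSmallBudgets

open ArithmeticFunction Finset

open Summit.ValiantsHypothesis.ValiantsHypothesis.Theorems.LiouvilleSarnakAligned
  (card_image_row_le_two_pow_rank)
open Summit.ValiantsHypothesis.ValiantsHypothesis.Theorems.LiouvilleSarnak.AlignedTypeI.CharactersModTwoN
  (ofBits_alignedCut ofBits_injective_boolVec)
open Summit.ValiantsHypothesis.ValiantsHypothesis.Theorems.LiouvilleSarnakLiouvilleCutRank.MultiplicativeBarrier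
  (exists_completelyMultiplicative_alignedRank_le_four)
open Summit.ValiantsHypothesis.ValiantsHypothesis.Theorems.LiouvilleSarnakLiouvilleCutRank.ModEightBarrier
  (exists_completelyMultiplicative_chi8_alignedRank_le_six)

/-- `λ(p) = -1` at a prime. [folklore] -/
theorem liouville_prime {p : ℕ} (hp : p.Prime) : liouville p = -1 := by
  rw [liouville_apply hp.ne_zero, cardFactors_apply_prime hp]; norm_num

/-- **Transfer from the aligned matrix to the aligned cut.**  For any `f : ℕ → ℤ` with values `±1` on the positive
integers, the number of distinct rows `r ↦ (c ↦ f(N_π(r,c)+1))` of the aligned cut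
`π = finSumFinEquiv.trans (finCongr (two_mul n).symm)` (row bits low) is at most `2^{rank}` of the aligned matrix
`(f(a + 2^n b + 1))_{a,b<2^n}`. [folklore] -/
theorem card_image_rows_alignedCut_le (n : ℕ) (f : ℕ → ℤ) (hf : ∀ m, 1 ≤ m → f m = 1 ∨ f m = -1) :
    ((univ : Finset (Fin n → Bool)).image (fun r c : Fin n → Bool =>
        f (Nat.ofBits (fun j : Fin (2 * n) =>
          Sum.elim r c ((finSumFinEquiv.trans (finCongr (two_mul n).symm)).symm j)) + 1))).card ≤
      2 ^ (Matrix.of fun a b : Fin (2 ^ n) => ((f ((a : ℕ) + 2 ^ n * (b : ℕ) + 1) : ℤ) : ℂ)).rank := by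
  classical
  -- the aligned matrix and its reindexing by `ofBits`
  set A : Matrix (Fin (2 ^ n)) (Fin (2 ^ n)) ℂ :=
    Matrix.of fun a b : Fin (2 ^ n) => ((f ((a : ℕ) + 2 ^ n * (b : ℕ) + 1) : ℤ) : ℂ) with hA
  have hbij : Function.Bijective
      (fun r : Fin n → Bool => (⟨Nat.ofBits r, Nat.ofBits_lt_two_pow r⟩ : Fin (2 ^ n))) := by
    rw [Fintype.bijective_iff_injective_and_card]
    exact ⟨fun r r' h => ofBits_injective_boolVec n (congrArg Fin.val h), by simp⟩
  set e : (Fin n → Bool) ≃ Fin (2 ^ n) := Equiv.ofBijective _ hbij with he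
  set M : Matrix (Fin n → Bool) (Fin n → Bool) ℂ := A.submatrix e e with hM
  have hMrank : M.rank = A.rank := by rw [hM, Matrix.rank_submatrix]
  have hApm : ∀ a b, A a b = 1 ∨ A a b = -1 := by
    intro a b
    rw [hA, Matrix.of_apply]
    rcases hf ((a : ℕ) + 2 ^ n * (b : ℕ) + 1) (by omega) with h | h
    · left; rw [h]; norm_num
    · right; rw [h]; norm_num
  have hMpm : ∀ r c, M r c = 1 ∨ M r c = -1 := fun r c => hApm _ _
  -- the integer row map factors through `M`'s rows by an injective cast
  set B : (Fin n → Bool) → (Fin n → Bool) → ℤ := fun r c =>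
    f (Nat.ofBits (fun j : Fin (2 * n) =>
      Sum.elim r c ((finSumFinEquiv.trans (finCongr (two_mul n).symm)).symm j)) + 1) with hB
  have hMB : ∀ r c, M r c = ((B r c : ℤ) : ℂ) := by
    intro r c
    simp only [hM, hA, hB, Matrix.submatrix_apply, Matrix.of_apply, he, Equiv.ofBijective_apply]
    rw [ofBits_alignedCut n r c]
  have hinj : Function.Injective (fun v : (Fin n → Bool) → ℤ => fun c => ((v c : ℤ) : ℂ)) := by
    intro v w h
    funext c
    have := congr_fun h c
    simp only at this
    exact_mod_cast this
  have hcomp : (fun r => M r) = (fun v : (Fin n → Bool) → ℤ => fun c => ((v c : ℤ) : ℂ)) ∘ B := by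
    funext r c
    simp only [Function.comp_apply]
    exact hMB r c
  have hrows : ((univ : Finset (Fin n → Bool)).image fun r => M r) =
      ((univ : Finset (Fin n → Bool)).image B).image
        (fun v : (Fin n → Bool) → ℤ => fun c => ((v c : ℤ) : ℂ)) := by
    rw [hcomp, ← Finset.image_image]
  calc ((univ : Finset (Fin n → Bool)).image B).card
      = (((univ : Finset (Fin n → Bool)).image B).image
          (fun v : (Fin n → Bool) → ℤ => fun c => ((v c : ℤ) : ℂ))).card :=
        (card_image_of_injective _ hinj).symm
    _ = ((univ : Finset (Fin n → Bool)).image fun r => M r).card := by rw [hrows]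
    _ ≤ 2 ^ M.rank := card_image_row_le_two_pow_rank M hMpm
    _ = 2 ^ A.rank := by rw [hMrank]

/-- ★ **`S_D` is false for budgets inside the `χ₈` pattern.**  If every `d ∈ D` is `2` or a prime
`≡ 3, 5 (mod 8)`, the relaxed-model hypothesis `S_D` of `…RelaxedModelBridge` fails: at every level the `χ₈`-twin
is a relaxed function with `≤ 2^6` distinct rows on the aligned cut. [this file] -/
theorem not_relaxedHypothesis_of_mod8 (D : Finset ℕ)
    (hD : ∀ d ∈ D, d = 2 ∨ (d.Prime ∧ (d % 8 = 3 ∨ d % 8 = 5))) :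
    ¬ (∀ W : ℕ, ∃ n : ℕ, ∀ g : ℕ → ℤ, (∀ m, 1 ≤ m → m ≤ 4 ^ n → g m = 1 ∨ g m = -1) →
      (∀ d ∈ D, ∀ m, 1 ≤ m → d * m ≤ 4 ^ n → g (d * m) = liouville d * g m) →
      ∀ π : Fin n ⊕ Fin n ≃ Fin (2 * n),
        2 ^ W ≤ ((univ : Finset (Fin n → Bool)).image (fun r c : Fin n → Bool =>
          g (Nat.ofBits (fun j : Fin (2 * n) => Sum.elim r c (π.symm j)) + 1))).card) := by
  intro h
  obtain ⟨f, hf1, hfmul, hf2, hf3, hf5, -, hfmod, hfrank⟩ :=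
    exists_completelyMultiplicative_chi8_alignedRank_le_six
  -- `f` is relaxed for `D`
  have hfD : ∀ d ∈ D, f d = liouville d := by
    intro d hd
    rcases hD d hd with rfl | ⟨hp, hmod⟩
    · rw [hf2, liouville_prime Nat.prime_two]
    · rw [hfmod d hmod, liouville_prime hp]
  -- take `W` large: `2^W > 2^6` and `2^W > 2^n` for small `n`
  obtain ⟨n, hn⟩ := h 7
  have hle := hn f (fun m hm _ => hf1 m hm)
    (fun d hd m hm _ => by
      have h1d : 1 ≤ d := by
        rcases hD d hd with rfl | ⟨hp, -⟩
        · norm_num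
        · exact hp.one_lt.le
      rw [hfmul d m h1d hm, hfD d hd])
    (finSumFinEquiv.trans (finCongr (two_mul n).symm))
  by_cases hn3 : 3 ≤ n
  · have h1 := card_image_rows_alignedCut_le n f hf1
    have h2 : 2 ^ (Matrix.of fun a b : Fin (2 ^ n) =>
        ((f ((a : ℕ) + 2 ^ n * (b : ℕ) + 1) : ℤ) : ℂ)).rank ≤ 2 ^ 6 :=
      Nat.pow_le_pow_right (by norm_num) (hfrank n hn3)
    have : (2 : ℕ) ^ 7 ≤ 2 ^ 6 := hle.trans (h1.trans h2)
    norm_num at this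
  · -- fewer than `2^7` rows exist at all
    have h1 : ((univ : Finset (Fin n → Bool)).image (fun r c : Fin n → Bool =>
        f (Nat.ofBits (fun j : Fin (2 * n) =>
          Sum.elim r c ((finSumFinEquiv.trans (finCongr (two_mul n).symm)).symm j)) + 1))).card ≤
        2 ^ n := by
      refine (Finset.card_image_le).trans ?_
      rw [Finset.card_univ, Fintype.card_fun, Fintype.card_bool, Fintype.card_fin]
    have h2 : 2 ^ n ≤ 2 ^ 2 := Nat.pow_le_pow_right (by norm_num) (by omega)
    have : (2 : ℕ) ^ 7 ≤ 2 ^ 2 := hle.trans (h1.trans h2)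
    norm_num at this

/-- ★ **`S_D` is false for budgets inside the `χ₄` pattern.**  If every `d ∈ D` is `2` or a prime
`≡ 3 (mod 4)`, the hypothesis `S_D` fails (the `χ₄`-twin of `…MultiplicativeBarrier`, aligned rank `≤ 4`).
[this file] -/
theorem not_relaxedHypothesis_of_mod4 (D : Finset ℕ)
    (hD : ∀ d ∈ D, d = 2 ∨ (d.Prime ∧ d % 4 = 3)) :
    ¬ (∀ W : ℕ, ∃ n : ℕ, ∀ g : ℕ → ℤ, (∀ m, 1 ≤ m → m ≤ 4 ^ n → g m = 1 ∨ g m = -1) →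
      (∀ d ∈ D, ∀ m, 1 ≤ m → d * m ≤ 4 ^ n → g (d * m) = liouville d * g m) →
      ∀ π : Fin n ⊕ Fin n ≃ Fin (2 * n),
        2 ^ W ≤ ((univ : Finset (Fin n → Bool)).image (fun r c : Fin n → Bool =>
          g (Nat.ofBits (fun j : Fin (2 * n) => Sum.elim r c (π.symm j)) + 1))).card) := by
  intro h
  obtain ⟨f, hf1, hfmul, hf2, hfmod, hfrank⟩ := exists_completelyMultiplicative_alignedRank_le_four
  have hfD : ∀ d ∈ D, f d = liouville d := by
    intro d hd
    rcases hD d hd with rfl | ⟨hp, hmod⟩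
    · rw [hf2, liouville_prime Nat.prime_two]
    · rw [hfmod d hmod, liouville_prime hp]
  obtain ⟨n, hn⟩ := h 5
  have hle := hn f (fun m hm _ => hf1 m hm)
    (fun d hd m hm _ => by
      have h1d : 1 ≤ d := by
        rcases hD d hd with rfl | ⟨hp, -⟩
        · norm_num
        · exact hp.one_lt.le
      rw [hfmul d m h1d hm, hfD d hd])
    (finSumFinEquiv.trans (finCongr (two_mul n).symm))
  by_cases hn2 : 2 ≤ n
  · have h1 := card_image_rows_alignedCut_le n f hf1
    have h2 : 2 ^ (Matrix.of fun a b : Fin (2 ^ n) =>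
        ((f ((a : ℕ) + 2 ^ n * (b : ℕ) + 1) : ℤ) : ℂ)).rank ≤ 2 ^ 4 :=
      Nat.pow_le_pow_right (by norm_num) (hfrank n hn2)
    have : (2 : ℕ) ^ 5 ≤ 2 ^ 4 := hle.trans (h1.trans h2)
    norm_num at this
  · have h1 : ((univ : Finset (Fin n → Bool)).image (fun r c : Fin n → Bool =>
        f (Nat.ofBits (fun j : Fin (2 * n) =>
          Sum.elim r c ((finSumFinEquiv.trans (finCongr (two_mul n).symm)).symm j)) + 1))).card ≤
        2 ^ n := by
      refine (Finset.card_image_le).trans ?_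
      rw [Finset.card_univ, Fintype.card_fun, Fintype.card_bool, Fintype.card_fin]
    have h2 : 2 ^ n ≤ 2 ^ 1 := Nat.pow_le_pow_right (by norm_num) (by omega)
    have : (2 : ℕ) ^ 5 ≤ 2 ^ 1 := hle.trans (h1.trans h2)
    norm_num at this

/-- The instance `D = {2, 3, 5}`. [this file] -/
theorem not_relaxedHypothesis_two_three_five :
    ¬ (∀ W : ℕ, ∃ n : ℕ, ∀ g : ℕ → ℤ, (∀ m, 1 ≤ m → m ≤ 4 ^ n → g m = 1 ∨ g m = -1) →
      (∀ d ∈ ({2, 3, 5} : Finset ℕ), ∀ m, 1 ≤ m → d * m ≤ 4 ^ n → g (d * m) = liouville d * g m) →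
      ∀ π : Fin n ⊕ Fin n ≃ Fin (2 * n),
        2 ^ W ≤ ((univ : Finset (Fin n → Bool)).image (fun r c : Fin n → Bool =>
          g (Nat.ofBits (fun j : Fin (2 * n) => Sum.elim r c (π.symm j)) + 1))).card) :=
  not_relaxedHypothesis_of_mod8 {2, 3, 5} (by
    intro d hd
    simp only [Finset.mem_insert, Finset.mem_singleton] at hd
    rcases hd with rfl | rfl | rfl
    · left; rfl
    · right; exact ⟨Nat.prime_three, by norm_num⟩
    · right; exact ⟨Nat.prime_five, by norm_num⟩)

/-- The instance `D = {2, 3, 7}`. [this file] -/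
theorem not_relaxedHypothesis_two_three_seven :
    ¬ (∀ W : ℕ, ∃ n : ℕ, ∀ g : ℕ → ℤ, (∀ m, 1 ≤ m → m ≤ 4 ^ n → g m = 1 ∨ g m = -1) →
      (∀ d ∈ ({2, 3, 7} : Finset ℕ), ∀ m, 1 ≤ m → d * m ≤ 4 ^ n → g (d * m) = liouville d * g m) →
      ∀ π : Fin n ⊕ Fin n ≃ Fin (2 * n),
        2 ^ W ≤ ((univ : Finset (Fin n → Bool)).image (fun r c : Fin n → Bool =>
          g (Nat.ofBits (fun j : Fin (2 * n) => Sum.elim r c (π.symm j)) + 1))).card) :=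
  not_relaxedHypothesis_of_mod4 {2, 3, 7} (by
    intro d hd
    simp only [Finset.mem_insert, Finset.mem_singleton] at hd
    rcases hd with rfl | rfl | rfl
    · left; rfl
    · right; exact ⟨Nat.prime_three, by norm_num⟩
    · right; exact ⟨by norm_num, by norm_num⟩)

end Summit.ValiantsHypothesis.ValiantsHypothesis.Theorems.LiouvilleSarnakLiouvilleCutRank.RelaxedModelSmallBudgets
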